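import Literature.Probability.LatticeModels.ScalingLimit3D
import Literature.Probability.LatticeModels.CriticalCorrWellDefined
import Literature.Probability.LatticeModels.CriticalWickDichotomy
import HarnessLib

/-!
# Crux `ConformalPoissonDevice.DeviceWeylUniversality` (stmt-CriticalPhenomena-4722), line `birth` —
# stub Z1 `stub_limitOdd`: odd scaling limits of the critical `ℤ³` correlators vanish

Route `ConformalPoissonDevice`, sub-problem `Ising3DConformalLimit`; stub Z1 of the lead's skeleton of
line `birth` (`Cruxes/DeviceWeylUniversality/Lines/birth.lean`). This file proves the registered stub
`stub_limitOdd` EXACTLY as registered: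

for every renormalisation `ρ : ℝ → ℝ`, every pointwise scaling limit `S` of the critical correlators
`criticalCorr 3` on `ℤ³` (`HasPointwiseScalingLimit (criticalCorr 3) ρ S`), every odd `n` and every
non-coincident configuration `x ∈ NonCoincident 3 n`, `S n x = 0`.

Proof. The odd critical correlators vanish identically on `ℤ^d`, `d ≥ 3`: a spin monomial with an odd
number of factors is a spin product `σ_A` with `|A|` odd, and `⟨σ_A⟩⁺_{β_c} = 0` for odd `|A|` because
`m*(β_c) = 0` (Aizenman–Duminil-Copin–Sidoravicius 2015; tree theorems
`spontaneousMagnetization_criticalBeta_eq_zero_holds`, `plusCorr_eq_zero_of_odd_card`,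
`criticalCorr_eq_zero_of_odd`). Hence the rescaled correlator `ρ(δ)^n · criticalCorr 3 n [x/δ]` is the
zero function of `δ`, and its limit `S n x` along `𝓝[>] 0` is `0` (uniqueness of limits). In the tree
this is exactly `HasPointwiseScalingLimit.eq_zero_of_odd` (`CriticalWickDichotomy.lean`) at `d = 3`.

## References

* M. Aizenman, H. Duminil-Copin, V. Sidoravicius, *Random currents and continuity of Ising model's
  spontaneous magnetization*, Comm. Math. Phys. 334 (2015), Thm. 1.2
  [AizenmanDuminilCopinSidoraviciusCMP2015].
-/

noncomputable section

namespace Summit.CriticalPhenomena.Ising3DConformalLimit.Theorems.DeviceWeylUniversality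

open Literature.Probability.LatticeModels

/-- **STUB Z1 — odd scaling limits vanish.** For any pointwise scaling limit `S` of the critical `ℤ³`
correlators (any renormalisation `ρ`) and odd `n`, `S n = 0` on `NonCoincident 3 n`: the odd critical
correlators vanish identically since `m*(β_c) = 0` in `d = 3` (Aizenman–Duminil-Copin–Sidoravicius
2015; tree `HasPointwiseScalingLimit.eq_zero_of_odd`, from
`spontaneousMagnetization_criticalBeta_eq_zero_holds` and `plusCorr_eq_zero_of_odd_card`), and the
limit of the zero function is zero. [cite: AizenmanDuminilCopinSidoraviciusCMP2015, Thm. 1.2] -/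
theorem stub_limitOdd :
    ∀ (ρ : ℝ → ℝ) (S : Literature.Probability.LatticeModels.CorrFamily 3),
    Literature.Probability.LatticeModels.HasPointwiseScalingLimit
      (Literature.Probability.LatticeModels.criticalCorr 3) ρ S
    → ∀ n : ℕ, Odd n → ∀ x ∈ Literature.Probability.LatticeModels.NonCoincident 3 n, S n x = 0 :=
  fun _ρ _S hlim _n hn _x hx => hlim.eq_zero_of_odd le_rfl hn hx

end Summit.CriticalPhenomena.Ising3DConformalLimit.Theorems.DeviceWeylUniversality

end
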